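import Literature.Computability.Complexity.ExtMonotoneGates
import Mathlib.LinearAlgebra.Matrix.PosDef
import Mathlib.Data.Matrix.Basis
import Mathlib.Tactic.Linarith
import Mathlib.Tactic.FieldSimp

/-!
# `CliqueExtLowerBound` (stmt-PneNP-10682, route PneNP/ConvexRankGates) — negative-side lemmas: uncertified CONV rejections

Standing-adversary (cdisprove, gen 2) probe for the crux
`Summit.PneNP.PneNP.Theses.ConvexRankGates.CliqueExtLowerBound`, CONV part, requested by the crux idea card
`certificates-on-the-defect` ("EXACT SDP feasibility can reject without a Farkas certificate … a
`_false_without_certified` probe would be informative"). A CONV gate of the route (`IsConvGate s`) accepts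
`v` iff `∃ Y ⪰ 0, ∀ i, tr(Aᵢ Y) ≤ bᵢ + (B v)ᵢ`; a *Farkas certificate* of rejection at `v` is `y ≥ 0` with
`∑ yᵢ Aᵢ ⪰ 0` and `y · (b + Bv) < 0` (`HasCertificate`). Proved here:

* `exists_convData_uncertified_rejection` — **CONV gates, as typed, may reject WITHOUT a certificate**: the
  data `A₀ = E₀₀, b₀ = 0, B₀ = 0; A₁ = -(E₀₁ + E₁₀), b₁ = -2, B₁ = 2` (width `p + q = 4`, `B ≥ 0`) realise
  the IDENTITY gate `v ↦ v₀`, and the rejection at `v₀ = 0` — `Y ⪰ 0, Y₀₀ ≤ 0, Y₀₁ + Y₁₀ ≥ 2` — is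
  infeasible (a psd matrix with `Y₀₀ = 0` has `Y₀₁ = 0`, `offDiag_eq_zero_of_posSemidef`) yet weakly
  infeasible: `y₀ E₀₀ - y₁ (E₀₁ + E₁₀) ⪰ 0` forces `y₁ = 0`, so no certificate exists.

So "every rejection is certified" is a property of the REALISATION (A, b, B), not of the gate function: an
argument through certificates must first re-realise its CONV gates (for diagonal = LP data every rejection is
certified, Farkas). Whether every CONV-realisable Boolean function has a fully certified realisation of
comparable width is left OPEN. References: M. Ramana, *An exact duality theory for semidefinite programming
and its complexity implications*, Math. Prog. 77 (1997) (weak infeasibility); Oliveira–Pudlák 2019 (LP gates).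
Refuter seat cdisprove-stmt-PneNP-10682-g2, 2026-08-15.
-/

namespace Summit.PneNP.PneNP.Theorems.CliqueExtLowerBound.Negative

open Literature.Computability.Complexity Matrix Finset

/-- A Farkas certificate of rejection of the CONV data `(A, b, B)` at the input `v`: `y ≥ 0` with
`∑ yᵢ Aᵢ ⪰ 0` and `y · (b + B v) < 0`. [folklore] -/
def HasCertificate {p q n : ℕ} (A : Fin p → Matrix (Fin q) (Fin q) ℝ) (b : Fin p → ℝ)
    (B : Fin p → Fin n → ℝ) (v : Fin n → Bool) : Prop :=
  ∃ y : Fin p → ℝ, (∀ i, 0 ≤ y i) ∧ (∑ i, y i • A i).PosSemidef ∧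
    ∑ i, y i * (b i + ∑ j, B i j * (if v j then (1 : ℝ) else 0)) < 0

/-- The quadratic form of a real `2 × 2` matrix at `(s, t)`. [folklore] -/
theorem quadForm_fin_two (M : Matrix (Fin 2) (Fin 2) ℝ) (s t : ℝ) :
    star ![s, t] ⬝ᵥ (M *ᵥ ![s, t]) = s * (M 0 0 * s + M 0 1 * t) + t * (M 1 0 * s + M 1 1 * t) := by
  simp [Matrix.mulVec, dotProduct, Fin.sum_univ_two]

/-- In a real psd `2 × 2` matrix a vanishing diagonal entry kills its row. [folklore] -/
theorem offDiag_eq_zero_of_posSemidef {Y : Matrix (Fin 2) (Fin 2) ℝ} (hY : Y.PosSemidef)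
    (h00 : Y 0 0 = 0) : Y 0 1 = 0 := by
  have hsymm : Y 1 0 = Y 0 1 := by
    have h := hY.1.apply 1 0
    simp only [star_trivial] at h
    exact h.symm
  by_contra hne
  have hq := hY.dotProduct_mulVec_nonneg ![-(Y 1 1 + 1) / (2 * Y 0 1), 1]
  rw [quadForm_fin_two, h00, hsymm] at hq
  have : -(Y 1 1 + 1) / (2 * Y 0 1) * (0 * (-(Y 1 1 + 1) / (2 * Y 0 1)) + Y 0 1 * 1) +
      1 * (Y 0 1 * (-(Y 1 1 + 1) / (2 * Y 0 1)) + Y 1 1 * 1) = -1 := by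
    field_simp
    ring
  linarith

/-- **CONV gates, as typed, may reject WITHOUT a Farkas certificate** (weak infeasibility): the data
`A₀ = E₀₀, b₀ = 0, B₀ = 0; A₁ = -(E₀₁ + E₁₀), b₁ = -2, B₁ = 2` realise the IDENTITY gate `v ↦ v₀`
(width `p + q = 4`, `B ≥ 0`), and the rejection at `v₀ = 0` — the system `Y ⪰ 0, Y₀₀ ≤ 0, Y₀₁ + Y₁₀ ≥ 2` —
is infeasible (psd with `Y₀₀ = 0` forces `Y₀₁ = 0`) yet uncertified (`y₀ E₀₀ - y₁ (E₀₁ + E₁₀) ⪰ 0` forces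
`y₁ = 0`). So "every rejection is certified" is a property of the REALISATION, not of the gate: an argument
through certificates (card `certificates-on-the-defect`) must first re-realise its CONV gates; for the LP
sub-class (diagonal data) Farkas makes every rejection certified. Whether every CONV-realisable Boolean
function has a fully certified realisation of comparable width is OPEN here. [folklore] -/
theorem exists_convData_uncertified_rejection :
    ∃ (A : Fin 2 → Matrix (Fin 2) (Fin 2) ℝ) (b : Fin 2 → ℝ) (B : Fin 2 → Fin 1 → ℝ),
      (∀ i j, 0 ≤ B i j) ∧
      (∀ v : Fin 1 → Bool, (∃ Y : Matrix (Fin 2) (Fin 2) ℝ, Y.PosSemidef ∧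
          ∀ i, (A i * Y).trace ≤ b i + ∑ j, B i j * (if v j then (1 : ℝ) else 0)) ↔ v 0 = true) ∧
      ¬ HasCertificate A b B (fun _ => false) := by
  refine ⟨![Matrix.single 0 0 1, -(Matrix.single 0 1 1 + Matrix.single 1 0 1)], ![0, -2],
    ![fun _ => 0, fun _ => 2], ?_, ?_, ?_⟩
  · intro i j
    fin_cases i <;> simp
  · intro v
    have htr0 : ∀ Y : Matrix (Fin 2) (Fin 2) ℝ, (Matrix.single 0 0 (1 : ℝ) * Y).trace = Y 0 0 := by
      intro Y; rw [Matrix.trace_single_mul, smul_eq_mul, one_mul]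
    have htr1 : ∀ Y : Matrix (Fin 2) (Fin 2) ℝ,
        (-(Matrix.single 0 1 (1 : ℝ) + Matrix.single 1 0 1) * Y).trace = -(Y 1 0 + Y 0 1) := by
      intro Y
      rw [Matrix.neg_mul, Matrix.trace_neg, Matrix.add_mul, Matrix.trace_add, Matrix.trace_single_mul,
        Matrix.trace_single_mul, smul_eq_mul, smul_eq_mul, one_mul, one_mul]
    constructor
    · rintro ⟨Y, hY, hc⟩
      by_contra hv
      have hv' : v 0 = false := by simpa using hv
      have h0 := hc 0
      have h1 := hc 1
      simp only [Matrix.cons_val_zero, Matrix.cons_val_one, Fin.sum_univ_one, hv',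
        Bool.false_eq_true, if_false, mul_zero, add_zero, htr0, htr1] at h0 h1
      have hnn : 0 ≤ Y 0 0 := hY.diag_nonneg
      have h00 : Y 0 0 = 0 := le_antisymm h0 hnn
      have h01 : Y 0 1 = 0 := offDiag_eq_zero_of_posSemidef hY h00
      have h10 : Y 1 0 = 0 := by
        have h := hY.1.apply 1 0
        simp only [star_trivial, h01] at h
        exact h.symm
      linarith
    · intro hv
      refine ⟨0, Matrix.PosSemidef.zero, fun i => ?_⟩
      fin_cases i
      · simp
      · simp [hv]
  · rintro ⟨y, hy, hpsd, hobj⟩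
    simp only [Fin.sum_univ_two, Matrix.cons_val_zero, Matrix.cons_val_one,
      Fin.sum_univ_one, Bool.false_eq_true, if_false, mul_zero, add_zero] at hobj hpsd
    -- the certificate matrix `y₀ E₀₀ - y₁ (E₀₁ + E₁₀)` is psd only if `y₁ = 0`
    have hy1 : y 1 = 0 := by
      by_contra hne
      have hpos : 0 < y 1 := lt_of_le_of_ne (hy 1) (Ne.symm hne)
      have hq := hpsd.dotProduct_mulVec_nonneg ![1, (y 0 + 1) / (2 * y 1)]
      rw [quadForm_fin_two] at hq
      simp [Matrix.add_apply, Matrix.neg_apply] at hq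
      have : y 0 - y 1 * ((y 0 + 1) / (2 * y 1)) - (y 0 + 1) / (2 * y 1) * y 1 = -1 := by
        field_simp
        ring
      nlinarith
    rw [hy1] at hobj
    norm_num at hobj

end Summit.PneNP.PneNP.Theorems.CliqueExtLowerBound.Negative
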